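import Summits.ABC.ABC.Theses.DefiniteXi
import Summits.ABC.ABC.Theorems.DefiniteXiEisensteinQuarantineLatticeDepthDvdIff
import Literature.NumberTheory.Automorphic.BrandtXiSetupIndependence
import Literature.NumberTheory.Automorphic.DefiniteOrderUnitsCardDvd
import HarnessLib

/-!
# Calibration of the occurrence bounds of line `Sketch` (crux `EisensteinQuarantine`,
stmt-ABC-15023): the `p`-adic half of the crux implies the occurrence bound at `p`

The line `Sketch` reduces the crux `Summit.ABC.ABC.Theses.DefiniteXi.EisensteinQuarantine` to two
OCCURRENCE BOUNDS (its stubs 3 and 4, at `p = 2` and `p = 3`): on the crux's domain (Frey curve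
`E_(a,b)`, conductor `N`, admissible `N⁻ = Nm`, any Brandt setup `S` of type `(N/Nm, Nm)`, `φ` a
generator of the `a(E)`-eigen-line of the Brandt matrices, `w` the Gross weights), a witness
`ψ ⊥_w φ` with `φ ≡ ψ (mod p^k)` forces `p^k ≤ C · N^ε · ordProj[p] 𝓛`,
`𝓛 = ∏_{q ∣ N, q ∤ Nm} ord_q Δ_min`.  The line's glue `half_of_occurrence` proves
"occurrence bound at `p` ⟹ `p`-adic half of the crux" (`ordProj[p] ξ ≤ 12 C · N^ε · ordProj[p] 𝓛`).

This file proves the CONVERSE transfer, for every prime `p`: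

* `occurrenceBound_of_ordProjHalf` — the `p`-adic half (`ordProj[p] ξ ≤ C · N^ε · ordProj[p] 𝓛`,
  `ξ = brandtXi (N/Nm) Nm (a(E))`) implies the occurrence bound at `p` with the SAME constant;
* `threeAdicOccurrenceBound_of_half` — the case `p = 3`: the hypothesis is verbatim the `h3` of the
  line's `sixPart_of_halves`, the conclusion verbatim the registered stub
  `stub_threeAdicOccurrenceBound`.

So each occurrence stub is EQUIVALENT (up to the factor `12` from `gcd_i (w_i φ_i) ∣ 12`) to the
corresponding per-prime half of the crux: the reduction of the line loses nothing, and a refutation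
/ proof of either form transfers.

Proof.  Given the witness, the dictionary `stub_latticeDepth_dvd_iff` (direction ←) gives
`p^k ∣ ξ_ℤ / d` with `ξ_ℤ = Σ_i w_i φ_i²`, `d = gcd_i (w_i φ_i)`; since `d ∣ ξ_ℤ`,
`ξ_ℤ = d · (ξ_ℤ / d)` and `p^k ∣ ξ_ℤ`.  The setup computes `ξ`: `brandtXi (N/Nm) Nm = S.xi`
(`Brandt.XiSetup.brandtXi_eq_xi`) and `S.xi = Σ_i w_i |φ_i|² = ξ_ℤ` on the line `ℤ φ`
(`Brandt.xi_eq_sum`), which is positive (`w_i ∣ 12`, `φ ≠ 0`).  Hence `p^k ∣ ξ ≠ 0`, so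
`p^k ≤ ordProj[p] ξ ≤ C · N^ε · ordProj[p] 𝓛`.
-/

-- `Summit.<Summit>.<Problem>`: for the single-conjunct summit `ABC` the duplicate `ABC.ABC` is mandated.
set_option linter.dupNamespace false

noncomputable section

namespace Summit.ABC.ABC.Theorems

open scoped BigOperators
open Literature.NumberTheory.Automorphic Literature.NumberTheory.EllipticCurves

/-- **On an eigen-line, an occurrence witness modulo `m` forces `m ∣ ξ_S`.**  In a Brandt setup `S`
of type `(N⁺, N⁻)` with Gross weights `w`, if the eigen-lattice of `λ` is the line `ℤ φ` (`φ ≠ 0`)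
and `ψ` is `w`-orthogonal to `φ` with `φ ≡ ψ (mod m)` (`m : ℕ`), then `m ∣ S.xi λ` and
`S.xi λ ≠ 0`.  (Dictionary `stub_latticeDepth_dvd_iff`, `d ∣ ξ_ℤ = Σ w_i φ_i²`, and
`S.xi λ = Σ w_i |φ_i|²` by `Brandt.xi_eq_sum`; positivity from `w_i ∣ 12`.) -/
theorem dvd_xi_of_occurrence {Nplus Nminus : ℕ} (S : Brandt.XiSetup Nplus Nminus) (lam : ℕ → ℤ)
    [Fintype (Brandt.ClassSet S.O)] {φ : Brandt.ClassSet S.O → ℤ} (hφ : φ ≠ 0)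
    (hL : Brandt.eigenLattice (Nplus * Nminus) (Brandt.matrix S.O) lam = ℤ ∙ φ)
    (m : ℕ) {ψ : Brandt.ClassSet S.O → ℤ}
    (hψ : ∑ i, (Brandt.weight S.O i : ℤ) * ψ i * φ i = 0) (hcong : ∀ i, (m : ℤ) ∣ φ i - ψ i) :
    m ∣ S.xi lam ∧ S.xi lam ≠ 0 := by
  set w : Brandt.ClassSet S.O → ℕ := Brandt.weight S.O with hw
  have hxi : S.xi lam = ∑ i, w i * (φ i).natAbs ^ 2 := by
    rw [Brandt.XiSetup.xi, Brandt.xiOfOrder_eq, Brandt.xi_eq_sum _ hφ hL]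
  -- `ξ_ℤ = Σ w_i φ_i²` is the integer cast of `S.xi λ`
  have hcast : (S.xi lam : ℤ) = ∑ i, (w i : ℤ) * φ i ^ 2 := by
    rw [hxi]
    push_cast
    exact Finset.sum_congr rfl fun i _ => by rw [sq_abs]
  -- the dictionary: the witness gives `m ∣ ξ_ℤ / d`, and `d ∣ ξ_ℤ`
  have hdict := (stub_latticeDepth_dvd_iff w φ (m : ℤ)).mpr ⟨ψ, hψ, hcong⟩
  have hdξ : Finset.univ.gcd (fun i => (w i : ℤ) * φ i) ∣ ∑ i, (w i : ℤ) * φ i ^ 2 := by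
    refine Finset.dvd_sum fun i _ => ?_
    rw [show (w i : ℤ) * φ i ^ 2 = (w i : ℤ) * φ i * φ i by ring]
    exact (Finset.gcd_dvd (Finset.mem_univ i)).mul_right _
  have hmZ : (m : ℤ) ∣ (S.xi lam : ℤ) := by
    rw [hcast, ← Int.mul_ediv_cancel' hdξ]
    exact hdict.mul_left _
  refine ⟨Int.natCast_dvd_natCast.mp hmZ, ?_⟩
  -- positivity on a line
  rw [hxi]
  obtain ⟨i, hi⟩ := Function.ne_iff.mp hφ
  have hwi : 0 < w i := Nat.pos_of_dvd_of_pos (S.weight_dvd_twelve i) (by norm_num)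
  exact (Finset.sum_pos' (fun _ _ => Nat.zero_le _)
    ⟨i, Finset.mem_univ _, Nat.mul_pos hwi (pow_pos (Int.natAbs_pos.mpr hi) 2)⟩).ne'

/-- **An occurrence modulo `p^k` forces `p^k ≤ ordProj[p] ξ`** (`p` prime): with `S`, `λ`, `φ`,
`ψ` as in `dvd_xi_of_occurrence` and `m = p^k`, `p^k ∣ S.xi λ ≠ 0`, hence
`p^k ≤ p^{v_p(S.xi λ)}`. -/
theorem pow_le_ordProj_xi_of_occurrence {p : ℕ} (hp : p.Prime) {Nplus Nminus : ℕ}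
    (S : Brandt.XiSetup Nplus Nminus) (lam : ℕ → ℤ) [Fintype (Brandt.ClassSet S.O)]
    {φ : Brandt.ClassSet S.O → ℤ} (hφ : φ ≠ 0)
    (hL : Brandt.eigenLattice (Nplus * Nminus) (Brandt.matrix S.O) lam = ℤ ∙ φ)
    (k : ℕ) {ψ : Brandt.ClassSet S.O → ℤ}
    (hψ : ∑ i, (Brandt.weight S.O i : ℤ) * ψ i * φ i = 0)
    (hcong : ∀ i, ((p ^ k : ℕ) : ℤ) ∣ φ i - ψ i) :
    p ^ k ≤ ordProj[p] (S.xi lam) := by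
  obtain ⟨hdvd, hne⟩ := dvd_xi_of_occurrence S lam hφ hL (p ^ k) hψ hcong
  exact Nat.pow_le_pow_right hp.pos ((hp.pow_dvd_iff_le_factorization hne).mp hdvd)

/-- **Calibration: the `p`-adic half of the crux implies the occurrence bound at `p`** (`p` prime).
If for every `ε > 0` some `C` bounds `ordProj[p] ξ ≤ C · N^ε · ordProj[p] 𝓛` on the crux's domain
(`ξ = brandtXi (N/Nm) Nm (a(E_(a,b)))`, `𝓛 = ∏_{q ∣ N, q ∤ Nm} ord_q Δ_min`), then with the SAME
`C`: for every Brandt setup `S` of type `(N/Nm, Nm)`, every generator `φ` of the `a(E)`-eigen-line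
and every `ψ ⊥_w φ` with `φ ≡ ψ (mod p^k)`, `p^k ≤ C · N^ε · ordProj[p] 𝓛` — because
`p^k ≤ ordProj[p] (S.xi) = ordProj[p] ξ` (`pow_le_ordProj_xi_of_occurrence`,
`Brandt.XiSetup.brandtXi_eq_xi`).  Converse of the line's `half_of_occurrence` (which costs the
factor `12`). -/
theorem occurrenceBound_of_ordProjHalf {p : ℕ} (hp : p.Prime)
    (hhalf : ∀ ε : ℝ, 0 < ε → ∃ C : ℝ, ∀ a b : ℤ, IsCoprime a b → a * b * (a + b) ≠ 0 →
      ∀ (N : ℕ) [NeZero N], (freyCurve a b).conductorNorm ℤ = N →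
      ∀ Nm : ℕ, Odd Nm → Squarefree Nm → Odd Nm.primeFactors.card → Nm ∣ N →
      ((ordProj[p] (brandtXi (N / Nm) Nm (fun n => (freyCurve a b).LFunction n)) : ℕ) : ℝ) ≤
        C * (N : ℝ) ^ ε *
          ((ordProj[p] (∏ q ∈ N.primeFactors \ Nm.primeFactors,
            ((freyCurve a b).minimalDiscriminantNorm ℤ).factorization q) : ℕ) : ℝ)) :
    ∀ ε : ℝ, 0 < ε → ∃ C : ℝ, ∀ a b : ℤ, IsCoprime a b → a * b * (a + b) ≠ 0 →
      ∀ (N : ℕ) [NeZero N], (freyCurve a b).conductorNorm ℤ = N →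
      ∀ Nm : ℕ, Odd Nm → Squarefree Nm → Odd Nm.primeFactors.card → Nm ∣ N →
      ∀ (S : Brandt.XiSetup (N / Nm) Nm) [Fintype (Brandt.ClassSet S.O)],
        ∀ φ : Brandt.ClassSet S.O → ℤ, φ ≠ 0 →
          Brandt.eigenLattice (N / Nm * Nm) (Brandt.matrix S.O)
              (fun n => (freyCurve a b).LFunction n) = ℤ ∙ φ →
          ∀ (k : ℕ) (ψ : Brandt.ClassSet S.O → ℤ),
            ∑ i, (Brandt.weight S.O i : ℤ) * ψ i * φ i = 0 →
            (∀ i, ((p ^ k : ℕ) : ℤ) ∣ φ i - ψ i) →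
            ((p ^ k : ℕ) : ℝ) ≤ C * (N : ℝ) ^ ε *
              ((ordProj[p] (∏ q ∈ N.primeFactors \ Nm.primeFactors,
                ((freyCurve a b).minimalDiscriminantNorm ℤ).factorization q) : ℕ) : ℝ) := by
  intro ε hε
  obtain ⟨C, hC⟩ := hhalf ε hε
  refine ⟨C, fun a b hab h0 N _ hN Nm hodd hsq hcard hdvd S _ φ hφ hL k ψ hψ hcong => ?_⟩
  have hle : p ^ k ≤ ordProj[p] (S.xi fun n => (freyCurve a b).LFunction n) :=
    pow_le_ordProj_xi_of_occurrence hp S _ hφ hL k hψ hcong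
  have hbound := hC a b hab h0 N hN Nm hodd hsq hcard hdvd
  rw [S.brandtXi_eq_xi] at hbound
  exact le_trans (by exact_mod_cast hle) hbound

/-- **Calibration at `p = 3`: the 3-adic half of the crux implies stub 4 of line `Sketch`.**  The
hypothesis is verbatim the `h3` consumed by the line's `sixPart_of_halves`
(`ordProj[3] ξ ≤ C · N^ε · ordProj[3] 𝓛` on the crux's domain); the conclusion is verbatim the
registered stub `stub_threeAdicOccurrenceBound`.  Together with the line's `half_of_occurrence 3`,
the stub is equivalent to the 3-adic half of `EisensteinQuarantine` with the per-prime allowance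
`ordProj[3] 𝓛` (constants `C ↦ C`, resp. `C ↦ 12 · max C 1`). -/
theorem threeAdicOccurrenceBound_of_half :
    (∀ ε : ℝ, 0 < ε → ∃ C : ℝ, ∀ a b : ℤ, IsCoprime a b → a * b * (a + b) ≠ 0 →
      ∀ (N : ℕ) [NeZero N], (freyCurve a b).conductorNorm ℤ = N →
      ∀ Nm : ℕ, Odd Nm → Squarefree Nm → Odd Nm.primeFactors.card → Nm ∣ N →
      ((ordProj[3] (brandtXi (N / Nm) Nm (fun n => (freyCurve a b).LFunction n)) : ℕ) : ℝ) ≤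
        C * (N : ℝ) ^ ε *
          ((ordProj[3] (∏ q ∈ N.primeFactors \ Nm.primeFactors,
            ((freyCurve a b).minimalDiscriminantNorm ℤ).factorization q) : ℕ) : ℝ)) →
    ∀ ε : ℝ, 0 < ε → ∃ C : ℝ, ∀ a b : ℤ, IsCoprime a b → a * b * (a + b) ≠ 0 →
      ∀ (N : ℕ) [NeZero N], (freyCurve a b).conductorNorm ℤ = N →
      ∀ Nm : ℕ, Odd Nm → Squarefree Nm → Odd Nm.primeFactors.card → Nm ∣ N →
      ∀ (S : Brandt.XiSetup (N / Nm) Nm) [Fintype (Brandt.ClassSet S.O)],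
        ∀ φ : Brandt.ClassSet S.O → ℤ, φ ≠ 0 →
          Brandt.eigenLattice (N / Nm * Nm) (Brandt.matrix S.O)
              (fun n => (freyCurve a b).LFunction n) = ℤ ∙ φ →
          ∀ (k : ℕ) (ψ : Brandt.ClassSet S.O → ℤ),
            ∑ i, (Brandt.weight S.O i : ℤ) * ψ i * φ i = 0 →
            (∀ i, ((3 ^ k : ℕ) : ℤ) ∣ φ i - ψ i) →
            ((3 ^ k : ℕ) : ℝ) ≤ C * (N : ℝ) ^ ε *
              ((ordProj[3] (∏ q ∈ N.primeFactors \ Nm.primeFactors,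
                ((freyCurve a b).minimalDiscriminantNorm ℤ).factorization q) : ℕ) : ℝ) :=
  fun h3 => occurrenceBound_of_ordProjHalf Nat.prime_three h3

end Summit.ABC.ABC.Theorems

end
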